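import Summits.AtomisticToContinuum.FouriersLaw.Theses.BondHeatUncertainty

/-!
# Fourth moment of the bath-site momentum under the Gibbs state of the pinned chain

Helper (`--supports`) for the line `bath-bond-deficit-integral` of the crux
`BondHeatUncertainty.SubdiffusiveBondHeat` (stmt-AtomisticToContinuum-9120): the registered stub
`stub_gibbsMomentumFourthMoment` of the lead's skeleton.

Under the Gibbs measure `μ_T = Z⁻¹ e^{-H/T} dq dp` of `pinnedChain ω₂ lam β γ`
(`OscillatorChain.gibbsMeasure`, `H = ∑ p_i²/2 + Φ(q)`) the momentum `p₀` is Gaussian `N(0,T)`;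
we prove `∫ p₀⁴ dμ_T = 3T²` (stated as `≤`, with integrability) by two integrations by parts in
the momentum direction `(0, e_0)` of phase space, using
`∂_{p_0} e^{-H/T} = -(p_0/T) e^{-H/T}` (`hasLineDerivAt_gibbsDensity`,
`hasLineDerivAt_hamiltonian_unitP`) and Mathlib's
`integral_bilinear_hasLineDerivAt_right_eq_neg_left_of_integrable` on the additive Haar measure
`volume` of `PhaseSpace N`:
`T⁻¹ ∫ p₀^{k+2} e^{-H/T} = (k+1) ∫ p₀^k e^{-H/T}` (`k = 0, 2`), whence
`∫ p₀⁴ e^{-H/T} = 3T ∫ p₀² e^{-H/T} = 3T² ∫ e^{-H/T}` and `∫ p₀⁴ dμ_T = 3T²`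
(`OscillatorChain.integral_gibbsMeasure`). Integrability of `p₀^k e^{-H/T}` (`k ≤ 4`):
`|p₀|^k ≤ 1 + p₀⁴ ≤ 4(1+H)²` (`H ≥ p₀²/2`, `pinnedChain_harmonic_le_hamiltonian`) and
`(1+H)² e^{-H/T} ≤ C e^{H/(2T)} e^{-H/T} ∈ L¹` (`one_add_sq_le_exp`,
`pinnedChain_integrable_exp_mul_gibbsDensity`).
-/

noncomputable section

open MeasureTheory

namespace Summit.AtomisticToContinuum.FouriersLaw.Theorems.SubdiffusiveBondHeat

open Literature.MathematicalPhysics.KineticTheory.HeatConduction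

variable {N : ℕ}

/-- Integration by parts along a direction `v` of phase space (Lebesgue measure) under
integrability hypotheses: if `F' g`, `F g'`, `F g` are integrable and `F'`, `g'` are the line
derivatives of `F`, `g` along `v` everywhere, then `∫ F g' = -∫ F' g`. [folklore] -/
theorem integral_mul_eq_neg_of_hasLineDerivAt_of_integrable
    {F F' g g' : PhaseSpace N → ℝ} {v : PhaseSpace N}
    (hF'g : Integrable fun x => F' x * g x) (hFg' : Integrable fun x => F x * g' x)
    (hFg : Integrable fun x => F x * g x)
    (hFd : ∀ x, HasLineDerivAt ℝ F (F' x) x v) (hgd : ∀ x, HasLineDerivAt ℝ g (g' x) x v) :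
    ∫ x, F x * g' x = -∫ x, F' x * g x := by
  haveI := isAddHaarMeasure_volume_phaseSpace N
  have e := integral_bilinear_hasLineDerivAt_right_eq_neg_left_of_integrable
    (μ := (volume : Measure (PhaseSpace N))) (B := ContinuousLinearMap.mul ℝ ℝ)
    (f := F) (f' := F') (g := g) (g' := g') (v := v) ?_ ?_ ?_ (fun x _ => hFd x) (fun x _ => hgd x)
  · simpa using e
  · simpa using hF'g
  · simpa using hFg'
  · simpa using hFg

/-- `∂_{p_i} p_i^n = n p_i^{n-1}`, as a line derivative along `(0, e_i)`. [folklore] -/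
theorem hasLineDerivAt_momentum_pow (n : ℕ) (x : PhaseSpace N) (i : Fin N) :
    HasLineDerivAt ℝ (fun z : PhaseSpace N => z.2 i ^ n) ((n : ℝ) * x.2 i ^ (n - 1)) x
      ((0, Pi.single i 1) : PhaseSpace N) := by
  unfold HasLineDerivAt
  have h : (fun t : ℝ => (fun z : PhaseSpace N => z.2 i ^ n)
      (x + t • ((0, Pi.single i 1) : PhaseSpace N))) = fun t => (x.2 i + t) ^ n := by
    funext t
    simp
  rw [h]
  have h1 : HasDerivAt (fun t : ℝ => x.2 i + t) 1 0 := (hasDerivAt_id' (0 : ℝ)).const_add _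
  refine (h1.fun_pow n).congr_deriv ?_
  simp

/-- `|t|^k ≤ 1 + t⁴` for `k ≤ 4`. [folklore] -/
theorem abs_pow_le_one_add_pow_four {k : ℕ} (hk : k ≤ 4) (t : ℝ) : |t| ^ k ≤ 1 + t ^ 4 := by
  have h4 : |t| ^ 4 = t ^ 4 := by
    rw [← abs_pow]
    exact abs_of_nonneg (by positivity)
  have ht4 : 0 ≤ t ^ 4 := by positivity
  rcases le_or_gt |t| 1 with h | h
  · have : |t| ^ k ≤ 1 := pow_le_one₀ (abs_nonneg t) h
    linarith
  · have : |t| ^ k ≤ |t| ^ 4 := pow_le_pow_right₀ h.le hk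
    linarith

section Pinned

variable {ω₂ lam β : ℝ}

/-- `|p_i^k| ≤ 4 (1 + H)²` for `k ≤ 4` (pinned chain, `lam, β ≥ 0`: `p_i² ≤ 2H`). [folklore] -/
theorem pinnedChain_abs_momentum_pow_le (hω : 0 ≤ ω₂) (hl : 0 ≤ lam) (hβ : 0 ≤ β) (γ : ℝ)
    (N : ℕ) (x : PhaseSpace N) (i : Fin N) {k : ℕ} (hk : k ≤ 4) :
    |x.2 i ^ k| ≤ 4 * (1 + (pinnedChain ω₂ lam β γ).hamiltonian N x) ^ 2 := by
  have h := pinnedChain_harmonic_le_hamiltonian (ω₂ := ω₂) hl hβ γ N x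
  have h1 : x.2 i ^ 2 / 2 ≤ ∑ k, x.2 k ^ 2 / 2 :=
    Finset.single_le_sum (f := fun k => x.2 k ^ 2 / 2) (fun k _ => by positivity)
      (Finset.mem_univ i)
  have h2 : 0 ≤ ∑ k, ω₂ * x.1 k ^ 2 / 2 := Finset.sum_nonneg fun k _ => by positivity
  have hp : x.2 i ^ 2 ≤ 2 * (pinnedChain ω₂ lam β γ).hamiltonian N x := by linarith
  have hp0 : 0 ≤ x.2 i ^ 2 := sq_nonneg _
  have h4 : x.2 i ^ 4 ≤ 4 * (pinnedChain ω₂ lam β γ).hamiltonian N x ^ 2 := by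
    have e : x.2 i ^ 4 = x.2 i ^ 2 * x.2 i ^ 2 := by ring
    rw [e]
    nlinarith
  have hH0 : 0 ≤ (pinnedChain ω₂ lam β γ).hamiltonian N x := by nlinarith
  rw [abs_pow]
  have := abs_pow_le_one_add_pow_four hk (x.2 i)
  nlinarith

/-- `(1 + H)² e^{-H/T}` is Lebesgue integrable for the pinned chain (`ω₂ > 0`, `lam, β ≥ 0`,
`T > 0`). [folklore] -/
theorem pinnedChain_integrable_one_add_sq_mul_gibbsDensity (hω : 0 < ω₂) (hl : 0 ≤ lam)
    (hβ : 0 ≤ β) (γ : ℝ) (N : ℕ) {T : ℝ} (hT : 0 < T) :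
    Integrable fun x => (1 + (pinnedChain ω₂ lam β γ).hamiltonian N x) ^ 2 *
      (pinnedChain ω₂ lam β γ).gibbsDensity N T x := by
  have hT' : 0 < T⁻¹ := inv_pos.mpr hT
  have hs : 0 < T⁻¹ / 2 := by positivity
  have hs' : T⁻¹ / 2 < 1 / T := by rw [one_div]; linarith
  have hmaj := (pinnedChain_integrable_exp_mul_gibbsDensity hω hl hβ γ N hT hs').const_mul
    (2 * Real.exp (T⁻¹ / 2) / (T⁻¹ / 2) ^ 2)
  refine hmaj.mono' ?_ (Filter.Eventually.of_forall fun x => ?_)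
  · exact (((continuous_const.add (pinnedChain_continuous_hamiltonian ω₂ lam β γ N)).pow 2).mul
      (pinnedChain_continuous_gibbsDensity ω₂ lam β γ N T)).aestronglyMeasurable
  have hH0 := pinnedChain_hamiltonian_nonneg hω.le hl hβ γ N x
  have hsq := one_add_sq_le_exp hH0 hs
  have hρ : 0 < (pinnedChain ω₂ lam β γ).gibbsDensity N T x :=
    (pinnedChain ω₂ lam β γ).gibbsDensity_pos N T x
  rw [Real.norm_eq_abs, abs_mul, abs_of_pos hρ, abs_of_nonneg (by positivity)]
  calc (1 + (pinnedChain ω₂ lam β γ).hamiltonian N x) ^ 2 *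
        (pinnedChain ω₂ lam β γ).gibbsDensity N T x
      ≤ 2 * Real.exp (T⁻¹ / 2) / (T⁻¹ / 2) ^ 2 *
          Real.exp (T⁻¹ / 2 * (pinnedChain ω₂ lam β γ).hamiltonian N x) *
          (pinnedChain ω₂ lam β γ).gibbsDensity N T x := mul_le_mul_of_nonneg_right hsq hρ.le
    _ = _ := by rw [mul_assoc]

/-- A continuous observable dominated by `C (1 + H)²` is integrable against `e^{-H/T}`
(pinned chain, `T > 0`). [folklore] -/
theorem pinnedChain_integrable_mul_gibbsDensity_of_le (hω : 0 < ω₂) (hl : 0 ≤ lam)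
    (hβ : 0 ≤ β) (γ : ℝ) (N : ℕ) {T : ℝ} (hT : 0 < T) {g : PhaseSpace N → ℝ} (hg : Continuous g)
    {C : ℝ} (hle : ∀ x, |g x| ≤ C * (1 + (pinnedChain ω₂ lam β γ).hamiltonian N x) ^ 2) :
    Integrable fun x => g x * (pinnedChain ω₂ lam β γ).gibbsDensity N T x := by
  have hmaj := (pinnedChain_integrable_one_add_sq_mul_gibbsDensity hω hl hβ γ N hT).const_mul C
  refine hmaj.mono'
    ((hg.mul (pinnedChain_continuous_gibbsDensity ω₂ lam β γ N T)).aestronglyMeasurable)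
    (Filter.Eventually.of_forall fun x => ?_)
  have hρ : 0 < (pinnedChain ω₂ lam β γ).gibbsDensity N T x :=
    (pinnedChain ω₂ lam β γ).gibbsDensity_pos N T x
  rw [Real.norm_eq_abs, abs_mul, abs_of_pos hρ, ← mul_assoc]
  exact mul_le_mul_of_nonneg_right (hle x) hρ.le

/-- `p_i^k e^{-H/T}` is Lebesgue integrable for `k ≤ 4` (pinned chain, `T > 0`). [folklore] -/
theorem pinnedChain_integrable_momentum_pow_mul_gibbsDensity (hω : 0 < ω₂) (hl : 0 ≤ lam)
    (hβ : 0 ≤ β) (γ : ℝ) (N : ℕ) {T : ℝ} (hT : 0 < T) (i : Fin N) {k : ℕ} (hk : k ≤ 4) :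
    Integrable fun x => x.2 i ^ k * (pinnedChain ω₂ lam β γ).gibbsDensity N T x :=
  pinnedChain_integrable_mul_gibbsDensity_of_le hω hl hβ γ N hT (by fun_prop)
    (fun x => pinnedChain_abs_momentum_pow_le hω.le hl hβ γ N x i hk)

/-- **Gaussian recursion for the momentum moments of `e^{-H/T}`.** For `k ≤ 2`,
`∫ p_i^{k+2} e^{-H/T} = T (k+1) ∫ p_i^k e^{-H/T}` (integration by parts in `p_i`:
`p_i^{k+2} e^{-H/T} = -T p_i^{k+1} ∂_{p_i} e^{-H/T}`). [folklore] -/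
theorem pinnedChain_integral_momentum_pow_add_two (hω : 0 < ω₂) (hl : 0 ≤ lam) (hβ : 0 ≤ β)
    (γ : ℝ) (N : ℕ) {T : ℝ} (hT : 0 < T) (i : Fin N) {k : ℕ} (hk : k ≤ 2) :
    ∫ x, x.2 i ^ (k + 2) * (pinnedChain ω₂ lam β γ).gibbsDensity N T x =
      T * (k + 1) * ∫ x, x.2 i ^ k * (pinnedChain ω₂ lam β γ).gibbsDensity N T x := by
  have hint : ∀ m : ℕ, m ≤ 4 →
      Integrable fun x => x.2 i ^ m * (pinnedChain ω₂ lam β γ).gibbsDensity N T x :=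
    fun m hm => pinnedChain_integrable_momentum_pow_mul_gibbsDensity hω hl hβ γ N hT i hm
  have e := integral_mul_eq_neg_of_hasLineDerivAt_of_integrable
    (F := fun x : PhaseSpace N => x.2 i ^ (k + 1))
    (F' := fun x : PhaseSpace N => ((k + 1 : ℕ) : ℝ) * x.2 i ^ (k + 1 - 1))
    (g := (pinnedChain ω₂ lam β γ).gibbsDensity N T)
    (g' := fun x => -(x.2 i / T) * (pinnedChain ω₂ lam β γ).gibbsDensity N T x)
    (v := ((0, Pi.single i 1) : PhaseSpace N)) ?_ ?_ ?_
    (fun x => hasLineDerivAt_momentum_pow (k + 1) x i)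
    (fun x => (pinnedChain ω₂ lam β γ).hasLineDerivAt_gibbsDensity
      ((pinnedChain ω₂ lam β γ).hasLineDerivAt_hamiltonian_unitP N x i))
  · have lhs : ∫ x, x.2 i ^ (k + 1) *
        (-(x.2 i / T) * (pinnedChain ω₂ lam β γ).gibbsDensity N T x) =
        -T⁻¹ * ∫ x, x.2 i ^ (k + 2) * (pinnedChain ω₂ lam β γ).gibbsDensity N T x := by
      rw [← integral_const_mul]
      refine integral_congr_ae (Filter.Eventually.of_forall fun x => ?_)
      ring
    have rhs : ∫ x, ((k + 1 : ℕ) : ℝ) * x.2 i ^ (k + 1 - 1) *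
        (pinnedChain ω₂ lam β γ).gibbsDensity N T x =
        ((k : ℝ) + 1) * ∫ x, x.2 i ^ k * (pinnedChain ω₂ lam β γ).gibbsDensity N T x := by
      rw [← integral_const_mul]
      refine integral_congr_ae (Filter.Eventually.of_forall fun x => ?_)
      simp only [Nat.add_sub_cancel, Nat.cast_add, Nat.cast_one]
      ring
    rw [lhs, rhs] at e
    have hTne : T ≠ 0 := hT.ne'
    have e2 : T⁻¹ * ∫ x, x.2 i ^ (k + 2) * (pinnedChain ω₂ lam β γ).gibbsDensity N T x =
        ((k : ℝ) + 1) * ∫ x, x.2 i ^ k * (pinnedChain ω₂ lam β γ).gibbsDensity N T x := by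
      linarith
    calc ∫ x, x.2 i ^ (k + 2) * (pinnedChain ω₂ lam β γ).gibbsDensity N T x
        = T * (T⁻¹ * ∫ x, x.2 i ^ (k + 2) * (pinnedChain ω₂ lam β γ).gibbsDensity N T x) := by
          rw [← mul_assoc, mul_inv_cancel₀ hTne, one_mul]
      _ = T * ((k : ℝ) + 1) * ∫ x, x.2 i ^ k * (pinnedChain ω₂ lam β γ).gibbsDensity N T x := by
          rw [e2, mul_assoc]
  · have h := hint k (by omega)
    refine (h.const_mul (((k + 1 : ℕ) : ℝ))).congr (Filter.Eventually.of_forall fun x => ?_)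
    simp only [Nat.add_sub_cancel]
    ring
  · have h := hint (k + 2) (by omega)
    refine (h.const_mul (-T⁻¹)).congr (Filter.Eventually.of_forall fun x => ?_)
    simp only
    ring
  · exact hint (k + 1) (by omega)

end Pinned

/-- **Stub `stub_gibbsMomentumFourthMoment`** (statics of the line `bath-bond-deficit-integral`):
under the Gibbs state `μ_T^N = Z⁻¹ e^{-H/T} dq dp` of the pinned anharmonic chain
`pinnedChain ω₂ lam β γ` (`H = ∑ p_i²/2 + Φ(q)`) the bath-site momentum `p₀` is exactly Gaussian
`N(0,T)`, so `p₀⁴` is integrable and `∫ p₀⁴ dμ_T^N ≤ 3T²` (in fact `= 3T²`), for every `N ≥ 1`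
and `T > 0`. [folklore] -/
theorem stub_gibbsMomentumFourthMoment :
    ∀ ω₂ lam β γ : ℝ, 0 < ω₂ → 0 < lam → 0 < β → 0 < γ → ∀ T : ℝ, 0 < T →
      ∀ (N : ℕ) (hN : 0 < N),
        Integrable (fun z : PhaseSpace N => (z.2 ⟨0, hN⟩) ^ 4) ((pinnedChain ω₂ lam β γ).gibbsMeasure N T) ∧
        ∫ z, (z.2 ⟨0, hN⟩) ^ 4 ∂((pinnedChain ω₂ lam β γ).gibbsMeasure N T) ≤ 3 * T ^ 2 := by
  intro ω₂ lam β γ hω hl hβ _hγ T hT N hN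
  set i : Fin N := ⟨0, hN⟩
  refine ⟨(pinnedChain ω₂ lam β γ).integrable_gibbsMeasure
    (pinnedChain_integrable_momentum_pow_mul_gibbsDensity hω hl.le hβ.le γ N hT i le_rfl), ?_⟩
  rw [(pinnedChain ω₂ lam β γ).integral_gibbsMeasure]
  have h4 := pinnedChain_integral_momentum_pow_add_two hω hl.le hβ.le γ N hT i (k := 2) le_rfl
  have h2 := pinnedChain_integral_momentum_pow_add_two hω hl.le hβ.le γ N hT i (k := 0)
    (Nat.zero_le _)
  have hZ : 0 < ∫ x, (pinnedChain ω₂ lam β γ).gibbsDensity N T x :=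
    integral_exp_pos (pinnedChain_integrable_gibbsDensity hω hl.le hβ.le γ N hT)
  have h0 : ∫ x, x.2 i ^ 0 * (pinnedChain ω₂ lam β γ).gibbsDensity N T x =
      ∫ x, (pinnedChain ω₂ lam β γ).gibbsDensity N T x := by
    simp
  simp only [Nat.reduceAdd, Nat.cast_ofNat, Nat.cast_zero, zero_add, mul_one] at h4 h2
  rw [h0] at h2
  rw [h4, h2]
  have e : (∫ x, (pinnedChain ω₂ lam β γ).gibbsDensity N T x)⁻¹ *
      (T * (2 + 1) * (T * ∫ x, (pinnedChain ω₂ lam β γ).gibbsDensity N T x)) = 3 * T ^ 2 := by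
    field_simp
    ring
  rw [e]

end Summit.AtomisticToContinuum.FouriersLaw.Theorems.SubdiffusiveBondHeat
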